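import Mathlib
import HarnessLib
import Literature.MathematicalPhysics.StatisticalMechanics.TorusMultiplierMatrices

/-!
# Every even kernel is a multiplier kernel; the finite-range decomposition in multiplier form
# (Buchholz §2; Adams–Buchholz–Kotecký–Müller Thm 6.1 / Remark 7.4)

`TorusMultiplierMatrices.lean` provides the functional calculus of the matrices `mulMat m` with a
real even Fourier multiplier `m`.  This file connects it to the objects of the finite-range
decomposition `GradientFRD.TorusFRD` (stated for abstract kernels `𝒞_k`):

* `fourierCoeff_conj_of_even`, `fourierCoeff_neg_of_even` — the Fourier coefficients of a real
  even kernel are real and even;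
* **`mulKernel_re_fourierCoeff`** — an even kernel IS the multiplier kernel of `Re 𝒞̂`:
  `mulKernel (κ ↦ Re 𝒞̂(κ)) = 𝒞`, hence `circulant 𝒞 = mulMat (Re 𝒞̂)` (`circulant_eq_mulMat`):
  every kernel of `TorusFRD` (clause (o): zero sum, even) is a multiplier matrix, with multiplier
  vanishing at `κ = 0` (`re_fourierCoeff_zero_of_sum_eq_zero`);
* `ellOp_eq_mulMat_mulVec` — `∇*A∇ = mulMat (symbR A)` for symmetric `A`;
* **`sum_re_fourierCoeff_mul_symbR_eq_one`** — clause (ii) of `TorusFRD` in Fourier variables: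
  if `∇*A∇ ((Σ_k 𝒞_k) ⋆ φ) = φ` for all zero-average `φ`, then `(Σ_k Re 𝒞̂_k(κ)) · â(κ) = 1` for
  every `κ ≠ 0` — the Green multiplier is the inverse symbol ([ABKM19] (6.4)–(6.5)).

Everything is proved; no named fact.

## References
* S. Buchholz, J. Funct. Anal. 275 (2018), §2 (2.14)–(2.19) [Buchholz2016].
* S. Adams, S. Buchholz, R. Kotecký, S. Müller, arXiv:1910.13564, Thm 6.1, (6.4)–(6.5), Remark 7.4
  [AdamsBuchholzKoteckyMuller2019].
-/

noncomputable section

namespace Literature.MathematicalPhysics.StatisticalMechanics.GradientFRD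

open Finset Matrix Complex Literature.Probability.LatticeModels
open scoped BigOperators ComplexConjugate

variable {d M : ℕ} [NeZero M]

/-! ## Fourier coefficients of even kernels -/

/-- The Fourier coefficients of a real EVEN kernel are real: `conj 𝒞̂(κ) = 𝒞̂(κ)`.
[cite: Buchholz2016, §2 (2.14)] -/
theorem fourierCoeff_conj_of_even {K : (Fin d → ZMod M) → ℝ} (hK : ∀ x, K (-x) = K x)
    (κ : Fin d → ZMod M) : conj (fourierCoeff K κ) = fourierCoeff K κ := by
  rw [fourierCoeff_eq_sum, map_sum]
  rw [← Equiv.sum_comp (Equiv.neg _) (fun x => (K x : ℂ) * conj (torusChar κ x))]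
  refine sum_congr rfl fun x _ => ?_
  rw [map_mul, Complex.conj_ofReal, Complex.conj_conj, Equiv.neg_apply, hK, torusChar_neg_right,
    Complex.conj_conj]

/-- Hence `𝒞̂(κ) = Re 𝒞̂(κ)` as a complex number. [cite: Buchholz2016, §2 (2.14)] -/
theorem fourierCoeff_eq_re_of_even {K : (Fin d → ZMod M) → ℝ} (hK : ∀ x, K (-x) = K x)
    (κ : Fin d → ZMod M) : fourierCoeff K κ = ((fourierCoeff K κ).re : ℂ) :=
  (Complex.conj_eq_iff_re.1 (fourierCoeff_conj_of_even hK κ)).symm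

/-- The Fourier coefficients of a real even kernel are even in `κ`. [cite: Buchholz2016, §2 (2.14)] -/
theorem fourierCoeff_neg_of_even {K : (Fin d → ZMod M) → ℝ} (hK : ∀ x, K (-x) = K x)
    (κ : Fin d → ZMod M) : fourierCoeff K (-κ) = fourierCoeff K κ := by
  rw [fourierCoeff_eq_sum, fourierCoeff_eq_sum,
    ← Equiv.sum_comp (Equiv.neg _) (fun x => (K x : ℂ) * conj (torusChar (-κ) x))]
  refine sum_congr rfl fun x _ => ?_
  rw [Equiv.neg_apply, hK, torusChar_neg_right, torusChar_comm, torusChar_neg_right, torusChar_comm,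
    Complex.conj_conj]

/-- The real multiplier `κ ↦ Re 𝒞̂(κ)` of an even kernel is even. [cite: Buchholz2016, §2 (2.14)] -/
theorem re_fourierCoeff_neg_of_even {K : (Fin d → ZMod M) → ℝ} (hK : ∀ x, K (-x) = K x)
    (κ : Fin d → ZMod M) : (fourierCoeff K (-κ)).re = (fourierCoeff K κ).re := by
  rw [fourierCoeff_neg_of_even hK]

/-- A zero-sum kernel has multiplier `0` at `κ = 0`. [cite: Buchholz2016, §1 (1.5)] -/
theorem re_fourierCoeff_zero_of_sum_eq_zero {K : (Fin d → ZMod M) → ℝ} (h0 : ∑ x, K x = 0) :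
    (fourierCoeff K 0).re = 0 := by
  rw [fourierCoeff_zero, h0]
  simp

/-! ## Even kernels are multiplier kernels -/

/-- **`mulKernel (Re 𝒞̂) = 𝒞` for an even kernel** (Fourier inversion).
[cite: Buchholz2016, §2 (2.15)] -/
theorem mulKernel_re_fourierCoeff {K : (Fin d → ZMod M) → ℝ} (hK : ∀ x, K (-x) = K x) :
    mulKernel (fun κ => (fourierCoeff K κ).re) = K := by
  funext x
  have hinv := fourierCoeff_inversion K x
  have h : mulSum (fun κ => (fourierCoeff K κ).re) x = (K x : ℂ) := by
    rw [hinv, mulSum]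
    congr 1
    exact sum_congr rfl fun κ _ => by rw [← fourierCoeff_eq_re_of_even hK]
  rw [mulKernel, h, Complex.ofReal_re]

/-- **`circulant 𝒞 = mulMat (Re 𝒞̂)`**: every even kernel (in particular every kernel of
`GradientFRD.TorusFRD`, clause (o)) is a multiplier matrix. [cite: AdamsBuchholzKoteckyMuller2019, Remark 7.4] -/
theorem circulant_eq_mulMat {K : (Fin d → ZMod M) → ℝ} (hK : ∀ x, K (-x) = K x) :
    Matrix.circulant K = mulMat (fun κ => (fourierCoeff K κ).re) := by
  rw [mulMat, mulKernel_re_fourierCoeff hK]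

/-- The convolution with an even kernel acts on Fourier coefficients by `Re 𝒞̂`.
[cite: Buchholz2016, §2 (2.17)] -/
theorem fourierCoeff_conv_of_even {K : (Fin d → ZMod M) → ℝ} (hK : ∀ x, K (-x) = K x)
    (φ : (Fin d → ZMod M) → ℝ) (κ : Fin d → ZMod M) :
    fourierCoeff (conv K φ) κ = ((fourierCoeff K κ).re : ℂ) * fourierCoeff φ κ := by
  rw [fourierCoeff_conv, ← fourierCoeff_eq_re_of_even hK]

/-! ## The elliptic operator as a multiplier matrix -/

/-- **`∇*A∇ φ = mulMat (symbR A) φ`** for symmetric `A`. [cite: Buchholz2016, §2 (2.18)] -/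
theorem ellOp_eq_mulMat_mulVec {A : Matrix (Fin d) (Fin d) ℝ} (hA : A.IsSymm)
    (φ : (Fin d → ZMod M) → ℝ) : ellOp A φ = mulMat (symbR A) *ᵥ φ := by
  refine eq_of_fourierCoeff_eq fun κ => ?_
  rw [fourierCoeff_ellOp, symb_eq_symbR hA, fourierCoeff_mulMat_mulVec (symbR_neg A)]

/-! ## Clause (ii) of the finite-range decomposition in Fourier variables -/

/-- A real test field with prescribed even spectrum: for `κ₀ ≠ 0` the field
`ψ = mulKernel (1_{κ₀} + 1_{−κ₀})` has zero sum and `ψ̂(κ₀) ≠ 0`. [cite: Buchholz2016, §2 (2.15)] -/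
theorem exists_test_field {κ₀ : Fin d → ZMod M} (hκ₀ : κ₀ ≠ 0) :
    ∃ ψ : (Fin d → ZMod M) → ℝ, ∑ x, ψ x = 0 ∧ fourierCoeff ψ κ₀ ≠ 0 := by
  classical
  set m : (Fin d → ZMod M) → ℝ := fun κ => (if κ = κ₀ then 1 else 0) + if κ = -κ₀ then 1 else 0
    with hm
  have hmev : ∀ κ, m (-κ) = m κ := fun κ => by
    simp only [hm, neg_eq_iff_eq_neg, neg_neg]
    by_cases h1 : κ = κ₀ <;> by_cases h2 : κ = -κ₀ <;> simp [h1, h2, add_comm]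
  refine ⟨mulKernel m, ?_, ?_⟩
  · rw [sum_mulKernel hmev, hm]
    simp only
    rw [if_neg (Ne.symm hκ₀), if_neg (fun h => hκ₀ (neg_eq_zero.1 h.symm)), add_zero]
  · rw [fourierCoeff_mulKernel hmev, hm]
    norm_cast
    simp only [if_true]
    by_cases h : κ₀ = -κ₀
    · rw [if_pos h]; norm_num
    · rw [if_neg h]; norm_num

/-- **Clause (ii) of `TorusFRD` in Fourier variables**: if the kernels `𝒞_k` (`k ∈ s`) are even and
`∇*A∇ ((Σ_{k∈s} 𝒞_k) ⋆ φ) = φ` for every zero-average `φ` (symmetric `A`), then the Green multiplier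
inverts the symbol off the zero mode: `(Σ_{k∈s} Re 𝒞̂_k(κ)) · â(κ) = 1` for `κ ≠ 0`
([ABKM19] (6.4)–(6.5): `Σ_k 𝒞_k = 𝒜⁻¹` on zero-average fields).
[cite: AdamsBuchholzKoteckyMuller2019, Thm 6.1 (ii) with (6.4)-(6.5)] -/
theorem sum_re_fourierCoeff_mul_symbR_eq_one {A : Matrix (Fin d) (Fin d) ℝ} (hA : A.IsSymm)
    {s : Finset ℕ} {𝒞 : ℕ → (Fin d → ZMod M) → ℝ} (heven : ∀ k ∈ s, ∀ x, 𝒞 k (-x) = 𝒞 k x)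
    (hinv : ∀ φ : (Fin d → ZMod M) → ℝ, ∑ x, φ x = 0 →
      ellOp A (conv (fun x => ∑ k ∈ s, 𝒞 k x) φ) = φ)
    {κ : Fin d → ZMod M} (hκ : κ ≠ 0) :
    (∑ k ∈ s, (fourierCoeff (𝒞 k) κ).re) * symbR A κ = 1 := by
  obtain ⟨ψ, hψ0, hψκ⟩ := exists_test_field hκ
  have hKev : ∀ x, (fun x => ∑ k ∈ s, 𝒞 k x) (-x) = (fun x => ∑ k ∈ s, 𝒞 k x) x := fun x => by
    simp only
    exact sum_congr rfl fun k hk => heven k hk x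
  have h : fourierCoeff (ellOp A (conv (fun x => ∑ k ∈ s, 𝒞 k x) ψ)) κ = fourierCoeff ψ κ := by
    rw [hinv ψ hψ0]
  rw [fourierCoeff_ellOp, symb_eq_symbR hA, fourierCoeff_conv_of_even hKev] at h
  -- cancel `ψ̂(κ) ≠ 0`
  have h2 : ((symbR A κ : ℂ) * ((fourierCoeff (fun x => ∑ k ∈ s, 𝒞 k x) κ).re : ℂ) - 1) *
      fourierCoeff ψ κ = 0 := by
    rw [sub_mul, one_mul, mul_assoc, h, sub_self]
  have h3 : (symbR A κ : ℂ) * ((fourierCoeff (fun x => ∑ k ∈ s, 𝒞 k x) κ).re : ℂ) = 1 := by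
    have := (mul_eq_zero.1 h2).resolve_right hψκ
    rwa [sub_eq_zero] at this
  -- the Fourier coefficient of the summed kernel is the sum
  have h4c : fourierCoeff (fun x => ∑ k ∈ s, 𝒞 k x) κ = ∑ k ∈ s, fourierCoeff (𝒞 k) κ := by
    simp_rw [fourierCoeff_eq_sum]
    conv_rhs => rw [Finset.sum_comm]
    refine sum_congr rfl fun x _ => ?_
    push_cast
    rw [Finset.sum_mul]
  have h4 : (fourierCoeff (fun x => ∑ k ∈ s, 𝒞 k x) κ).re = ∑ k ∈ s, (fourierCoeff (𝒞 k) κ).re := by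
    rw [h4c, Complex.re_sum]
  rw [h4] at h3
  have h6 : ((symbR A κ * (∑ k ∈ s, (fourierCoeff (𝒞 k) κ).re) : ℝ) : ℂ) = 1 := by
    rw [Complex.ofReal_mul]; exact h3
  have h5 : symbR A κ * (∑ k ∈ s, (fourierCoeff (𝒞 k) κ).re) = 1 := by exact_mod_cast h6
  rw [mul_comm]; exact h5

end Literature.MathematicalPhysics.StatisticalMechanics.GradientFRD

end
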